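import Summits.BirchSwinnertonDyer.BirchSwinnertonDyer.Theorems.ClassRecordThreeEulerHalvesAtThreeCartanCoverAssembly
import Summits.BirchSwinnertonDyer.BirchSwinnertonDyer.Theorems.ClassRecordThreeEulerHalvesAtThreeCartanTransportCoverReductionExists
import Summits.BirchSwinnertonDyer.BirchSwinnertonDyer.Theorems.ClassRecordThreeEulerHalvesAtThreeCartanSatOfNoFixed
import Mathlib.GroupTheory.Transfer
import Mathlib.LinearAlgebra.Matrix.GeneralLinearGroup.Card
import Summits.BirchSwinnertonDyer.BirchSwinnertonDyer.Theorems.ClassRecordThreeEulerHalvesAtThreeCartanCoverInvariantHomExt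
import Summits.BirchSwinnertonDyer.BirchSwinnertonDyer.Theorems.ClassRecordThreeEulerHalvesAtThreeCartanCoverTorusPinning
import HarnessLib

/-!
# (D4) from three leaves: (M0) strong approximation, (EXT), (OBS) — crux `CartanOnePlaceDegreeLawAtThree` (NUM, stmt-BirchSwinnertonDyer-24801), line `charext`

Typed and proved by the crux ideator `cruxidea-stmt-BirchSwinnertonDyer-24801-1` g0 in the crux workfile
`Cruxes/CartanOnePlaceDegreeLawAtThree/Lines/charext.lean` v8 (sha16 f08f5e2103847d91, farm rc 0); LANDED here (namespace moved under `Theorems`,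
statements byte-identical, shared period lemmas made `private`) by the LEAD of the crux (bsd-stepL tam3-p1 g27) so that every line of the crux can
import the reduction BY NAME (`--supports stmt-BirchSwinnertonDyer-24801`). Nothing here is specific to a curve; BSD is proved for no curve.

(7′) `dockedLineSaturation_of_charext : StrongApproxAtCartanPlace → InvariantHomExtendsSL2 → NoModThreePeriodCharacterExtension → DockedLineSaturation`:
for `v = c·u_C ∈ 𝕃` the function `ψ = c·per_F` is `Λ`-valued on `Γ̄(q)` and `ι(O₀'¹)`-conjugation invariant modulo `3Λ` (component evaluation at
`g = redHom γ`); (EXT) in `Λ∕3Λ` (image `SL₂(𝔽_q)` by (M0) and `det_redHom`) extends `ψ mod 3Λ` to `coverUnits X q`; (OBS) forces `ψ(Γ̄(q)) ⊆ 3Λ`; then every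
component of `v∕3` has its periods in `Λ`. COMPOSITION `saturationAtThree_of_leaves : CartanCover.PeriodLatticeCharacter → StrongApproxAtCartanPlace →
NoModThreePeriodCharacterExtension → CartanCover.SaturationAtThree` — so the content stub (D4) of `Lines/lattice` v5 ∕ `Lines/charext` v8 is TWO PRINT facts
((M) Eichler–Shimura character of the period lattice, (M0) strong approximation) plus ONE Galois leaf (OBS). [cite: DiamondTaylor1994, Thm. 1 and §1]
[cite: Voight2021, Thm. 28.5.3 and Cor. 28.5.4] [cite: KohenPacetti2016, Rem. 3.8 (arXiv:1403.7801v3 p. 15)]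
-/

set_option linter.dupNamespace false
set_option autoImplicit false

noncomputable section

open scoped Classical Pointwise MatrixGroups UpperHalfPlane

namespace Summit.BirchSwinnertonDyer.BirchSwinnertonDyer.Theorems.CartanCover.Charext

open Summit.BirchSwinnertonDyer.BirchSwinnertonDyer.Theorems
open Literature.NumberTheory.Automorphic WeierstrassCurve Literature.NumberTheory.EllipticCurves.Rank1Residual
  Summit.BirchSwinnertonDyer.Rank1Residual

/-- **(M0) STRONG APPROXIMATION AT THE CARTAN PLACE** [PRINT]: the reduction `redHom : ι(O₀'¹) → GL₂(𝔽_q)` is ONTO `SL₂(𝔽_q)` (Eichler–Kneser strong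
approximation for the indefinite algebra `B`: `O₀'¹` is dense in `∏_p (O₀')_p¹`, and `(O₀' ⊗ 𝔽_q)¹ = SL₂(𝔽_q)` by `red_surjective` ∕ `det_red`). With
`det_redHom` the image is exactly `SL₂(𝔽_q)`. Why it might fail: it does not (B indefinite). [cite: Voight2021, Thm. 28.5.3 and Cor. 28.5.4] -/
@[conjecture]
def StrongApproxAtCartanPlace : Prop :=
  ∀ (D M : ℕ) (C : Finset ℕ) (X : CartanLevelCurveData D M C) (q : ℕ) [Fact q.Prime], q ∈ C →
    ∀ (R : CartanCover.CoverReduction X q) (g : GL (Fin 2) (ZMod q)),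
      Matrix.det (g : Matrix (Fin 2) (Fin 2) (ZMod q)) = 1 → ∃ γ : CartanCover.coverUnits X q, R.redHom γ = g

/-- **(OBS) NO MOD-3 EXTENSION OF THE PERIOD CHARACTER TO LEVEL PRIME TO `q`** [THE GALOIS LEAF]: at a principal-series Cartan place `q ≡ 1 (3)` of the
`X11b ∧ Surj`-curve `V`, if a `Λ(W₁)`-valued function `χ` on `ι(O₀'¹) = coverUnits X q` is a homomorphism modulo `3Λ` and restricts on `Γ̄(q)` to a complex multiple
`c·per_F` of the period character of the class-minimal form `F = Q.form` (mod `3Λ`), then `c·per_F(Γ̄(q)) ⊆ 3Λ`. Route (print chain): the extension is unique and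
Hecke-eigen with `V`'s eigenvalues (`Γ̄(q)` normally generates, `SL₂(𝔽_q)` perfect); a non-zero eigenclass in `H¹(ι(O₀'¹), 𝔽₃)` is not elliptic-Eisenstein
(`ρ̄_{V,3}` irreducible), so lifts (Deligne–Serre) to a weight-`2` eigenform of level prime to `q`, whence (Jacquet–Langlands, Carayol) `ρ̄_{V,3}` unramified at `q` —
but `e_q(V) = 3` and `ker(GL₂(ℤ₃) → GL₂(𝔽₃))` is torsion-free, so `ρ̄_{V,3}(I_q)` has order `3`. Why it might fail: a mod-`3` congruence between `V` and a
level-`DM∏_{C∖q}p²` form would do it — exactly what the ramification of `ρ̄_{V,3}` at `q` forbids; NOT IN PRINT as stated (cocompact `H¹`, elliptic classes).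
[cite: DiamondTaylor1994, Thm. 1 and §1] [cite: KohenPacetti2016, Rem. 3.8 (arXiv:1403.7801v3 p. 15)] -/
@[conjecture]
def NoModThreePeriodCharacterExtension : Prop :=
  ∀ (V : WeierstrassCurve ℚ) [V.IsElliptic] [V.IsGloballyMinimal], ClassX11b V 3 → Surj V 3 →
    ∀ (N D M : ℕ) (C : Finset ℕ) (q : ℕ) [Fact q.Prime]
      (X : CartanLevelCurveData D M C) (W₁ : WeierstrassCurve ℚ) [W₁.IsElliptic] (Q : CartanParametrizationData X W₁),
      q ∈ C → V.conductorNorm ℤ = N → D * M * ∏ p ∈ C, p ^ 2 = N → q ≠ 3 → ¬ q ^ 3 ∣ N →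
      3 ∣ (V.baseChange ℚ_[q]).localTamagawaNumber ℤ_[q] → Q.IsMinimalFor V → q % 3 = 1 →
      ∀ (c : ℂ) (χ : GL (Fin 2) ℝ → ℂ),
        (∀ γ ∈ CartanCover.coverUnits X q, χ γ ∈ Q.L.lattice) →
        (∀ γ ∈ CartanCover.coverUnits X q, ∀ δ ∈ CartanCover.coverUnits X q,
          ∃ y ∈ Q.L.lattice, χ (γ * δ) - χ γ - χ δ = 3 * y) →
        (∀ β ∈ CartanCover.principalLevel X q,
          ∃ y ∈ Q.L.lattice, χ β - c * segmentIntegral (⇑Q.form) Q.basePoint (β • Q.basePoint) = 3 * y) →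
        ∀ β ∈ CartanCover.principalLevel X q,
          ∃ y ∈ Q.L.lattice, c * segmentIntegral (⇑Q.form) Q.basePoint (β • Q.basePoint) = 3 * y

section D3Lemmas

variable {Γ : Subgroup (GL (Fin 2) ℝ)} [Γ.HasDetOne]

/-- Elements of `Γ ≤ SL₂(ℝ)` have positive determinant.
-- adapted from Literature/NumberTheory/Automorphic/ShimuraCurvePeriodsHeckeIntegralityProofs.lean §2 (no hub olean in this closure) [folklore] -/
private theorem det_val_pos_of_mem' {γ : GL (Fin 2) ℝ} (hγ : γ ∈ Γ) : 0 < γ.det.val := by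
  rw [Subgroup.HasDetOne.det_eq hγ, Units.val_one]; exact one_pos

/-- `Γ`-invariance of segment integrals: `∫_{γz}^{γw} h = ∫_z^w h`. [folklore] -/
private theorem segmentIntegral_smul_smul' (h : CuspForm Γ 2) {γ : GL (Fin 2) ℝ} (hγ : γ ∈ Γ) (z w : ℍ) :
    segmentIntegral h (γ • z) (γ • w) = segmentIntegral h z w := by
  have e := CartanDegree.segmentIntegral_slash_inv_smul h (det_val_pos_of_mem' hγ) (γ • z) w
  rw [SlashInvariantForm.slash_action_eqn h γ hγ, inv_smul_smul] at e
  exact e.symm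

/-- The period `∫_τ^{γτ} h` does not depend on the base point. [folklore] -/
private theorem period_eq_period' (h : CuspForm Γ 2) {γ : GL (Fin 2) ℝ} (hγ : γ ∈ Γ) (z w : ℍ) :
    segmentIntegral h z (γ • z) = segmentIntegral h w (γ • w) := by
  have e1 := segmentIntegral_sub_segmentIntegral h w z (γ • z)
  have e2 := segmentIntegral_sub_segmentIntegral h w (γ • w) (γ • z)
  have e3 := segmentIntegral_smul_smul' h hγ w z
  linear_combination (-1 : ℂ) * e1 + e2 + e3

omit [Γ.HasDetOne] in
/-- `∫_z^z h = 0`. [folklore] -/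
private theorem period_one' (h : CuspForm Γ 2) (z : ℍ) : segmentIntegral h z ((1 : GL (Fin 2) ℝ) • z) = 0 := by
  have e := segmentIntegral_sub_segmentIntegral h z z z
  rw [sub_self] at e
  rw [one_smul]
  exact e.symm

/-- Additivity of periods: `γ ↦ ∫_z^{γz} h` is a homomorphism on `Γ`. [folklore] -/
private theorem period_mul' (h : CuspForm Γ 2) {γ : GL (Fin 2) ℝ} (hγ : γ ∈ Γ) (δ : GL (Fin 2) ℝ) (z : ℍ) :
    segmentIntegral h z ((γ * δ) • z) = segmentIntegral h z (γ • z) + segmentIntegral h z (δ • z) := by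
  have e1 := segmentIntegral_sub_segmentIntegral h z (δ • z) ((γ * δ) • z)
  have e2 : segmentIntegral h (δ • z) ((γ * δ) • z) = segmentIntegral h z (γ • z) := by
    rw [mul_smul]; exact (period_eq_period' h hγ z (δ • z)).symm
  linear_combination e1 + e2


end D3Lemmas

/-- Constants pass through segment integrals. [folklore] -/
private theorem segmentIntegral_const_smul' (c : ℂ) (s : ℍ → ℂ) (z w : ℍ) :
    segmentIntegral (c • s) z w = c * segmentIntegral s z w := by
  simp only [segmentIntegral, Pi.smul_apply, smul_eq_mul]
  rw [← intervalIntegral.integral_const_mul]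
  congr 1; funext t; ring

section DLSLemmas

variable {D M : ℕ} {C : Finset ℕ} {X : CartanLevelCurveData D M C} {q : ℕ}

/-- Periods of `ρ(γ) F|_{Γ̄(q)}` along `β ∈ Γ̄(q)` are the periods of `F` along `γ⁻¹ β γ`. [folklore] -/
theorem period_coverRep (hq : q ∈ C) (F : CuspForm X.Gamma 2) (γ : CartanCover.coverUnits X q) {β : GL (Fin 2) ℝ}
    (hβ : β ∈ CartanCover.principalLevel X q) (z w : ℍ) :
    segmentIntegral (⇑(CartanCover.coverRep X q γ (CartanCover.restrictGamma hq F))) z (β • z)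
      = segmentIntegral (⇑F) w (((γ : GL (Fin 2) ℝ)⁻¹ * β * γ) • w) := by
  rw [CartanCover.coverRep_apply, CartanCover.coe_coverSlash, CartanCover.coe_restrictGamma]
  have hg : 0 < ((γ : GL (Fin 2) ℝ)⁻¹).det.val := by
    rw [map_inv, Units.val_inv_eq_inv_val]
    exact inv_pos.mpr (CartanCover.det_pos_of_mem_coverUnits X q γ.2)
  have h := CartanDegree.segmentIntegral_slash_inv_smul F hg ((γ : GL (Fin 2) ℝ)⁻¹ • z) (β • z)
  rw [inv_smul_smul] at h
  rw [h]
  have e : (γ : GL (Fin 2) ℝ)⁻¹ • β • z = ((γ : GL (Fin 2) ℝ)⁻¹ * β * γ) • ((γ : GL (Fin 2) ℝ)⁻¹ • z) := by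
    simp only [mul_smul, smul_inv_smul]
  rw [e]
  have hmem : (γ : GL (Fin 2) ℝ)⁻¹ * β * γ ∈ X.Gamma := by
    have := CartanCover.conj_mem_principalLevel X q ((CartanCover.coverUnits X q).inv_mem γ.2) hβ
    rw [inv_inv] at this
    exact CartanCover.principalLevel_le_Gamma X q hq this
  exact period_eq_period' F hmem _ _

variable [Fact q.Prime] (R : CartanCover.CoverReduction X q) {W₁ : WeierstrassCurve ℚ}

/-- Step 1: if `c·u_C ∈ 𝕃` then `c·per_F(β) ∈ Λ` for `β ∈ Γ̄(q)` (the `1`-component). [folklore] -/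
theorem smul_period_mem (hq : q ∈ C) (Q : CartanParametrizationData X W₁) (c : ℂ) (v : R.IndCuspForm)
    (hvL : v ∈ R.periodLattice Q.L.lattice (R.dockNonsplit hq Q.form)) (hc : v = c • R.dockNonsplit hq Q.form)
    {β : GL (Fin 2) ℝ} (hβ : β ∈ CartanCover.principalLevel X q) (z : ℍ) :
    c * segmentIntegral (⇑Q.form) z (β • z) ∈ Q.L.lattice := by
  have h1 : v.1 1 = c • CartanCover.restrictGamma hq Q.form := by
    rw [hc, Submodule.coe_smul, Pi.smul_apply, R.dockNonsplit_apply_one]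
  have hP := ((R.mem_periodLattice_iff _ _ _).mp hvL).2 1 β hβ z
  rw [h1, CuspForm.IsGLPos.coe_smul, segmentIntegral_const_smul', CartanCover.coe_restrictGamma] at hP
  exact hP

/-- Step 2: `G`-invariance of `c·u_C` modulo `3𝕃` at `g = redHom γ` says `c·per_F(γ⁻¹ β γ) − c·per_F(β) ∈ 3Λ` on `Γ̄(q)`. [folklore] -/
theorem smul_period_conj_sub (hq : q ∈ C) (Q : CartanParametrizationData X W₁) (c : ℂ) (v : R.IndCuspForm)
    (hc : v = c • R.dockNonsplit hq Q.form) (γ : CartanCover.coverUnits X q) (w : R.IndCuspForm)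
    (hwL : w ∈ R.periodLattice Q.L.lattice (R.dockNonsplit hq Q.form)) (hw : R.indRep (R.redHom γ) v - v = w + w + w)
    {β : GL (Fin 2) ℝ} (hβ : β ∈ CartanCover.principalLevel X q) :
    ∃ y ∈ Q.L.lattice, c * segmentIntegral (⇑Q.form) Q.basePoint (((γ : GL (Fin 2) ℝ)⁻¹ * β * γ) • Q.basePoint)
      - c * segmentIntegral (⇑Q.form) Q.basePoint (β • Q.basePoint) = 3 * y := by
  have hwit : (R.redHom γ)⁻¹ * R.redHom γ ∈ CartanTorusCubeCut.torusSubgroup R.η := by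
    rw [inv_mul_cancel]; exact (CartanTorusCubeCut.torusSubgroup R.η).one_mem
  have e := congrArg (fun f : R.IndCuspForm => f.1 1) hw
  simp only [Submodule.coe_sub, Submodule.coe_add, Pi.sub_apply, Pi.add_apply, CartanCover.CoverReduction.indRep_apply, one_mul] at e
  rw [hc, Submodule.coe_smul, Pi.smul_apply, Pi.smul_apply, R.dockNonsplit_apply_of_witness hq Q.form hwit, R.dockNonsplit_apply_one] at e
  have hW : HasPeriodsIn (CartanCover.principalLevel X q) (⇑(w.1 1)) (Q.L.lattice : Set ℂ) := ((R.mem_periodLattice_iff _ _ _).mp hwL).2 1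
  refine ⟨segmentIntegral (⇑(w.1 1)) Q.basePoint (β • Q.basePoint), hW β hβ Q.basePoint, ?_⟩
  have e2 := congrArg (fun G : CuspForm (CartanCover.principalLevel X q) 2 => segmentIntegral (⇑G) Q.basePoint (β • Q.basePoint)) e
  rw [sub_eq_add_neg, CartanCover.segmentIntegral_coe_add, CartanCover.segmentIntegral_coe_neg, CartanCover.segmentIntegral_coe_add,
    CartanCover.segmentIntegral_coe_add, CuspForm.IsGLPos.coe_smul, CuspForm.IsGLPos.coe_smul, segmentIntegral_const_smul',
    segmentIntegral_const_smul', period_coverRep hq Q.form γ hβ Q.basePoint Q.basePoint, CartanCover.coe_restrictGamma] at e2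
  linear_combination e2

/-- Step 5: once `c·per_F(Γ̄(q)) ⊆ 3Λ`, every component of `c·u_C ∕ 3` has its `Γ̄(q)`-periods in `Λ`, so `c·u_C ∕ 3 ∈ 𝕃`. [folklore] -/
theorem third_smul_mem_periodLattice (hq : q ∈ C) (Q : CartanParametrizationData X W₁) (c : ℂ) (v : R.IndCuspForm)
    (hvL : v ∈ R.periodLattice Q.L.lattice (R.dockNonsplit hq Q.form)) (hc : v = c • R.dockNonsplit hq Q.form)
    (h3 : ∀ β ∈ CartanCover.principalLevel X q, ∃ y ∈ Q.L.lattice,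
      c * segmentIntegral (⇑Q.form) Q.basePoint (β • Q.basePoint) = 3 * y) :
    ((3 : ℂ)⁻¹ • v) ∈ R.periodLattice Q.L.lattice (R.dockNonsplit hq Q.form) := by
  refine (R.mem_periodLattice_iff _ _ _).mpr ⟨Submodule.smul_mem _ _ ((R.mem_periodLattice_iff _ _ _).mp hvL).1, ?_⟩
  intro g
  rw [Submodule.coe_smul, Pi.smul_apply, hc, Submodule.coe_smul, Pi.smul_apply]
  by_cases hg : g ∈ R.nonsplitCoset
  · obtain ⟨γ, hγ⟩ := hg
    rw [R.dockNonsplit_apply_of_witness hq Q.form hγ, ← map_smul, ← map_smul]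
    refine CartanCover.hasPeriodsIn_coverRep γ _ ?_
    intro β hβ z
    rw [CuspForm.IsGLPos.coe_smul, CuspForm.IsGLPos.coe_smul, segmentIntegral_const_smul', segmentIntegral_const_smul',
      CartanCover.coe_restrictGamma, period_eq_period' Q.form (CartanCover.principalLevel_le_Gamma X q hq hβ) z Q.basePoint]
    obtain ⟨y, hy, e⟩ := h3 β hβ
    rw [e, ← mul_assoc, inv_mul_cancel₀ (three_ne_zero : (3 : ℂ) ≠ 0), one_mul]
    exact hy
  · rw [R.dockNonsplit_apply_of_not hq Q.form hg, smul_zero, smul_zero]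
    exact CartanCover.hasPeriodsIn_zero' Q.L.lattice

include R in
/-- Steps 3–4: (M0) + (EXT) in `Λ ∕ 3Λ`-coordinates — a `Λ`-valued function on `Γ̄(q)`, additive and `ι(O₀'¹)`-conjugation-invariant modulo `3Λ`,
extends modulo `3Λ` to a `Λ`-valued quasi-homomorphism on `ι(O₀'¹) = coverUnits X q`. [folklore] -/
theorem exists_modThree_extension (hM0 : StrongApproxAtCartanPlace) (hE : InvariantHomExtendsSL2)
    (hq : q ∈ C) (hq1 : q % 3 = 1) (Λ : Submodule ℤ ℂ) (ψ : GL (Fin 2) ℝ → ℂ)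
    (hψΛ : ∀ β ∈ CartanCover.principalLevel X q, ψ β ∈ Λ)
    (hψadd : ∀ β₁ ∈ CartanCover.principalLevel X q, ∀ β₂ ∈ CartanCover.principalLevel X q, ψ (β₁ * β₂) = ψ β₁ + ψ β₂)
    (hψconj : ∀ γ ∈ CartanCover.coverUnits X q, ∀ β ∈ CartanCover.principalLevel X q, ∃ y ∈ Λ, ψ (γ * β * γ⁻¹) - ψ β = 3 * y) :
    ∃ χ : GL (Fin 2) ℝ → ℂ,
      (∀ γ ∈ CartanCover.coverUnits X q, χ γ ∈ Λ) ∧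
      (∀ γ ∈ CartanCover.coverUnits X q, ∀ δ ∈ CartanCover.coverUnits X q, ∃ y ∈ Λ, χ (γ * δ) - χ γ - χ δ = 3 * y) ∧
      (∀ β ∈ CartanCover.principalLevel X q, ∃ y ∈ Λ, χ β - ψ β = 3 * y) := by
  -- the 3-torsion module `A = Λ ∕ 3Λ`
  obtain ⟨p3, hp3⟩ : ∃ p3 : Submodule ℤ Λ, ∀ x : Λ, x ∈ p3 ↔ ∃ y : Λ, (3 : ℤ) • y = x :=
    ⟨LinearMap.range ((3 : ℤ) • (LinearMap.id : Λ →ₗ[ℤ] Λ)), fun x => by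
      simp only [LinearMap.mem_range, LinearMap.smul_apply, LinearMap.id_coe, id_eq]⟩
  have h3A : ∀ a : Λ ⧸ p3, (3 : ℤ) • a = 0 := by
    intro a
    obtain ⟨x, rfl⟩ := Submodule.Quotient.mk_surjective p3 a
    have e : Submodule.Quotient.mk (p := p3) ((3 : ℤ) • x) = (3 : ℤ) • Submodule.Quotient.mk (p := p3) x :=
      Submodule.Quotient.mk_smul p3 (3 : ℤ) x
    rw [← e, Submodule.Quotient.mk_eq_zero, hp3]
    exact ⟨x, rfl⟩
  obtain ⟨χA, hχA⟩ : ∃ χA : CartanCover.coverUnits X q → Λ ⧸ p3, ∀ (γ : CartanCover.coverUnits X q)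
      (h : (γ : GL (Fin 2) ℝ) ∈ CartanCover.principalLevel X q), χA γ = Submodule.Quotient.mk ⟨ψ γ, hψΛ γ h⟩ :=
    ⟨fun γ => if h : (γ : GL (Fin 2) ℝ) ∈ CartanCover.principalLevel X q then Submodule.Quotient.mk ⟨ψ γ, hψΛ γ h⟩ else 0,
      fun γ h => dif_pos h⟩
  have himg : ∀ g : GL (Fin 2) (ZMod q), (∃ γ, R.redHom γ = g) ↔ Matrix.det (g : Matrix (Fin 2) (Fin 2) (ZMod q)) = 1 := by
    intro g; constructor
    · rintro ⟨γ, rfl⟩; exact R.det_redHom γ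
    · exact hM0 D M C X q hq R g
  have hker : ∀ β : CartanCover.coverUnits X q, R.redHom β = 1 ↔ (β : GL (Fin 2) ℝ) ∈ CartanCover.principalLevel X q :=
    fun β => R.mem_ker_redHom_iff β
  have hadd : ∀ β₁ β₂ : CartanCover.coverUnits X q, R.redHom β₁ = 1 → R.redHom β₂ = 1 → χA (β₁ * β₂) = χA β₁ + χA β₂ := by
    intro β₁ β₂ h₁ h₂
    have h₁' := (hker β₁).mp h₁
    have h₂' := (hker β₂).mp h₂
    have h₁₂ : ((β₁ * β₂ : CartanCover.coverUnits X q) : GL (Fin 2) ℝ) ∈ CartanCover.principalLevel X q := by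
      rw [Subgroup.coe_mul]; exact (CartanCover.principalLevel X q).mul_mem h₁' h₂'
    rw [hχA _ h₁', hχA _ h₂', hχA _ h₁₂, ← Submodule.Quotient.mk_add]
    congr 1
    apply Subtype.ext
    show ψ ((β₁ * β₂ : CartanCover.coverUnits X q) : GL (Fin 2) ℝ) = ψ β₁ + ψ β₂
    rw [Subgroup.coe_mul]
    exact hψadd _ h₁' _ h₂'
  have hconjA : ∀ γ β : CartanCover.coverUnits X q, R.redHom β = 1 → χA (γ * β * γ⁻¹) = χA β := by
    intro γ β hβ
    have hβ' := (hker β).mp hβ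
    have hc' : ((γ * β * γ⁻¹ : CartanCover.coverUnits X q) : GL (Fin 2) ℝ) ∈ CartanCover.principalLevel X q := by
      rw [Subgroup.coe_mul, Subgroup.coe_mul, Subgroup.coe_inv]
      exact CartanCover.conj_mem_principalLevel X q γ.2 hβ'
    rw [hχA _ hβ', hχA _ hc', Submodule.Quotient.eq p3, hp3]
    obtain ⟨y, hy, e⟩ := hψconj γ γ.2 β hβ'
    refine ⟨⟨y, hy⟩, Subtype.ext ?_⟩
    show (((3 : ℤ) • (⟨y, hy⟩ : Λ) : Λ) : ℂ) = ψ ((γ * β * γ⁻¹ : CartanCover.coverUnits X q) : GL (Fin 2) ℝ) - ψ β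
    rw [Submodule.coe_smul, Subgroup.coe_mul, Subgroup.coe_mul, Subgroup.coe_inv, e, zsmul_eq_mul]
    push_cast
    ring
  obtain ⟨χ', hχ'add, hχ'res⟩ := hE q hq1 (CartanCover.coverUnits X q) (Λ ⧸ p3) R.redHom χA h3A himg hadd hconjA
  -- lift back to `Λ`
  choose lift hlift using Submodule.Quotient.mk_surjective p3
  refine ⟨fun g => if h : g ∈ CartanCover.coverUnits X q then ((lift (χ' ⟨g, h⟩) : Λ) : ℂ) else 0, ?_, ?_, ?_⟩
  · intro γ hγ
    simp only [dif_pos hγ]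
    exact (lift _).2
  · intro γ hγ δ hδ
    have hγδ : γ * δ ∈ CartanCover.coverUnits X q := (CartanCover.coverUnits X q).mul_mem hγ hδ
    simp only [dif_pos hγ, dif_pos hδ, dif_pos hγδ]
    have e2 : χ' ⟨γ * δ, hγδ⟩ = χ' ⟨γ, hγ⟩ + χ' ⟨δ, hδ⟩ := hχ'add ⟨γ, hγ⟩ ⟨δ, hδ⟩
    have e' : Submodule.Quotient.mk (p := p3) (lift (χ' ⟨γ * δ, hγδ⟩))
        = Submodule.Quotient.mk (lift (χ' ⟨γ, hγ⟩) + lift (χ' ⟨δ, hδ⟩)) := by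
      rw [Submodule.Quotient.mk_add, hlift, hlift, hlift, e2]
    rw [Submodule.Quotient.eq p3, hp3] at e'
    obtain ⟨y, hy⟩ := e'
    refine ⟨y, y.2, ?_⟩
    have e3 := congrArg (fun x : Λ => (x : ℂ)) hy
    simp only [Submodule.coe_smul, Submodule.coe_sub, Submodule.coe_add, zsmul_eq_mul, Int.cast_ofNat] at e3
    linear_combination (-1 : ℂ) * e3
  · intro β hβ
    have hβU : β ∈ CartanCover.coverUnits X q :=
      CartanCover.Gamma_le_coverUnits X q (CartanCover.principalLevel_le_Gamma X q hq hβ)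
    simp only [dif_pos hβU]
    have e := hχ'res ⟨β, hβU⟩ ((hker ⟨β, hβU⟩).mpr hβ)
    have e' : Submodule.Quotient.mk (p := p3) (lift (χ' ⟨β, hβU⟩)) = Submodule.Quotient.mk ⟨ψ β, hψΛ β hβ⟩ := by
      rw [hlift, e, hχA ⟨β, hβU⟩ hβ]
    rw [Submodule.Quotient.eq p3, hp3] at e'
    obtain ⟨y, hy⟩ := e'
    refine ⟨y, y.2, ?_⟩
    have e3 := congrArg (fun x : Λ => (x : ℂ)) hy
    simp only [Submodule.coe_smul, Submodule.coe_sub, zsmul_eq_mul, Int.cast_ofNat] at e3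
    linear_combination (-1 : ℂ) * e3

end DLSLemmas

/-- **(7′) PROVED (was `stub_dockedLineSaturation_of_charext` in v1–v3): (M0) → (EXT) → (OBS) → (DLS).** For `v = c·u_C ∈ 𝕃` with `ρ(g)v − v ∈ 3𝕃` for all `g`: the `1`-components at `g = redHom γ` give that
`ψ = c·per_F` is `Λ`-valued on `Γ̄(q)` and `ι(O₀'¹)`-conjugation invariant modulo `3Λ`; (EXT) in `Λ∕3Λ` (image of `redHom` = `SL₂(𝔽_q)` by (M0) and
`det_redHom`) extends `ψ mod 3Λ` to `coverUnits X q`; (OBS) forces `ψ(Γ̄(q)) ⊆ 3Λ`; then every component `c·ρ(γ)F̄ ∕ 3` of `v ∕ 3` has its `Γ̄(q)`-periods in `Λ`. [cite: KohenPacetti2016, Rem. 3.8 (arXiv:1403.7801v3 p. 15)] -/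
theorem dockedLineSaturation_of_charext (hM0 : StrongApproxAtCartanPlace) (hE : InvariantHomExtendsSL2)
    (hO : NoModThreePeriodCharacterExtension) : DockedLineSaturation := by
  intro V _ _ h11 hS N D M C q _ X W₁ _ Q hq R hN hDMC hq3 hq3N hcq hQ hq1 v hvc hv
  obtain ⟨c, hc⟩ := hvc
  have hv' : ∀ γ : CartanCover.coverUnits X q, ∃ w : R.IndCuspForm, w ∈ R.periodLattice Q.L.lattice (R.dockNonsplit hq Q.form) ∧
      R.indRep (R.redHom γ) (v : R.IndCuspForm) - v = w + w + w := by
    intro γ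
    obtain ⟨w, hw⟩ := hv (R.redHom γ)
    refine ⟨w, w.2, ?_⟩
    have h3 : ((3 : ℤ) • w : R.periodLattice Q.L.lattice (R.dockNonsplit hq Q.form)) = w + w + w := by
      rw [show (3 : ℤ) = 1 + 1 + 1 by norm_num, add_zsmul, add_zsmul, one_zsmul]
    rw [h3] at hw
    have e := congrArg (fun x : R.periodLattice Q.L.lattice (R.dockNonsplit hq Q.form) => (x : R.IndCuspForm)) hw
    simpa only [AddSubgroup.coe_sub, AddSubgroup.coe_add, CartanCover.CoverReduction.coe_latticeRep_apply] using e
  have hΛ1 : ∀ β ∈ CartanCover.principalLevel X q, c * segmentIntegral (⇑Q.form) Q.basePoint (β • Q.basePoint) ∈ Q.L.lattice :=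
    fun β hβ => smul_period_mem R hq Q c v v.2 hc hβ Q.basePoint
  have hconj : ∀ γ ∈ CartanCover.coverUnits X q, ∀ β ∈ CartanCover.principalLevel X q, ∃ y ∈ Q.L.lattice,
      c * segmentIntegral (⇑Q.form) Q.basePoint ((γ * β * γ⁻¹) • Q.basePoint)
        - c * segmentIntegral (⇑Q.form) Q.basePoint (β • Q.basePoint) = 3 * y := by
    intro γ hγ β hβ
    obtain ⟨w, hwL, hw⟩ := hv' ⟨γ⁻¹, (CartanCover.coverUnits X q).inv_mem hγ⟩
    have := smul_period_conj_sub R hq Q c v hc ⟨γ⁻¹, (CartanCover.coverUnits X q).inv_mem hγ⟩ w hwL hw hβ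
    simpa only [inv_inv] using this
  have hadd : ∀ β₁ ∈ CartanCover.principalLevel X q, ∀ β₂ ∈ CartanCover.principalLevel X q,
      c * segmentIntegral (⇑Q.form) Q.basePoint ((β₁ * β₂) • Q.basePoint)
        = c * segmentIntegral (⇑Q.form) Q.basePoint (β₁ • Q.basePoint) + c * segmentIntegral (⇑Q.form) Q.basePoint (β₂ • Q.basePoint) := by
    intro β₁ hβ₁ β₂ _
    rw [period_mul' Q.form (CartanCover.principalLevel_le_Gamma X q hq hβ₁) β₂ Q.basePoint, mul_add]
  obtain ⟨χ, hχΛ, hχadd, hχres⟩ := exists_modThree_extension R hM0 hE hq hq1 Q.L.lattice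
    (fun g => c * segmentIntegral (⇑Q.form) Q.basePoint (g • Q.basePoint)) hΛ1 hadd hconj
  have hOBS := hO V h11 hS N D M C q X W₁ Q hq hN hDMC hq3 hq3N hcq hQ hq1 c χ hχΛ hχadd hχres
  have hmem := third_smul_mem_periodLattice R hq Q c v v.2 hc hOBS
  refine ⟨⟨(3 : ℂ)⁻¹ • (v : R.IndCuspForm), hmem⟩, Subtype.ext ?_⟩
  rw [AddSubgroupClass.coe_zsmul]
  show (v : R.IndCuspForm) = (3 : ℤ) • ((3 : ℂ)⁻¹ • (v : R.IndCuspForm))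
  rw [← Int.cast_smul_eq_zsmul ℂ, smul_smul]
  norm_num


/-- **(D4) FROM THE LEAVES**: (M) the character of the period lattice [print], (M0) strong approximation at `q` [print] and (OBS) the one Galois
leaf imply `CartanCover.SaturationAtThree`, by the torus pinning (`saturation_of_pinning`, with (ZC) `centralCharacterTrivial` and (TFL𝕃)
`torusFixedLineLattice_of_character hM`) applied to the docked-line residual (`dockedLineSaturation_of_charext hM0 invariantHomExtendsSL2 hOBS`).
[cite: KohenPacetti2016, Rem. 3.8 (arXiv:1403.7801v3 p. 15)] -/
theorem saturationAtThree_of_leaves (hM : CartanCover.PeriodLatticeCharacter) (hM0 : StrongApproxAtCartanPlace)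
    (hOBS : NoModThreePeriodCharacterExtension) : CartanCover.SaturationAtThree :=
  saturation_of_pinning centralCharacterTrivial (torusFixedLineLattice_of_character hM)
    (dockedLineSaturation_of_charext hM0 invariantHomExtendsSL2 hOBS)

end Summit.BirchSwinnertonDyer.BirchSwinnertonDyer.Theorems.CartanCover.Charext

end
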